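import Mathlib
import Summits.ValiantsHypothesis.ValiantsHypothesis.Theorems.KPlusLogSqLawTropicalBSeparable

/-!
# Route «KPlusLogSqLaw», crux `TropicalB` (stmt-ValiantsHypothesis-19771) — THE TWO-SIDED SEPARABLE SECTOR, part 2: THE MOVE INEQUALITY
# (dominance prices every balanced family of class moves)

HONEST FRAMING.  Helper toward the registered stubs `stub_tropThin` / `stub_tropFat` of `Cruxes/TropicalB/Lines/birth.lean` (crux
`Summit.ValiantsHypothesis.ValiantsHypothesis.Theses.KPlusLogSqLaw.TropicalB`, item stmt-ValiantsHypothesis-19771, route KPlusLogSqLaw;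
cell `pub-symmetroid`, seat val-sym-trop-p1 g19, 2026-08-28; `--supports … --as helper`).  A SECTOR lemma about dominance designs of a
special shape (below); nothing here bounds `TropicalB` for general designs, and nothing bears on `WeakLifting`, DoorA26 / DoorA34,
`MatrixDescartes` (stmt-ValiantsHypothesis-18050) or VP ≠ VNP.  Part 1 = `…TropicalBClassCircuits` (circuits of class moves); part 3 =
`…TropicalBTwoSidedSeparable` (the potential step and the chain law).

THE SECTOR (two-sided separable designs with a fine tie-break).  Format `(m, K)`; a COARSE SCALE `M : ℕ`; exponents on the coarse
scale, `d l = M · e l`; valuations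
  `v a b l = M · (r a l + c b l) + w a b`
— a ROW-CLASS part `r`, a COLUMN-CLASS part `c` (the «two-sided separable», Barvinok-rank-`K` coarse part) and an arbitrary
CLASS-INDEPENDENT fine perturbation `0 ≤ w a b ≤ B` with `m·B < M` (a tie-break of the permutation) — and FULL SUPPORT (`ε a b l ≠ 0`).
Without the tie-break (`w = 0`) such designs have no dominant term at all when `K < m` (`…TropicalBSeparable`); with it the permutation
is free to move, and the hub census of this seat (pure-python exact evaluation of the sector, 2026-08-28) shows chains of length `2m` at
`K = 3` and `≈ 3m–4m` at `K = 4` — the sector is in-window, dense and non-trivial.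

THE MOVE INEQUALITY (`move_ineq`).  Let `p` be dominant at the integer slope `θ` and `p'` ANY other term.  The agents (rows, columns)
whose class under `p'` differs from that under `p` are read as ARCS on the class set `Fin K`: a row `a` gives the arc
(class of `a` in `p`) → (class of `a` in `p'`), a column `b` the REVERSED arc (class of `b` in `p'`) → (class of `b` in `p`).  For a
nonempty sub-family `S` of changed agents that is BALANCED (every class has as many heads as tails in `S` — exactly the condition that
moving the agents of `S` to their `p'`-classes keeps «row histogram = column histogram»), some Leibniz term realises the moved class
maps (`exists_perm_of_card_eq`, a fibrewise bijection), it is present (full support), and dominance of `p` against it reads, after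
dividing by the coarse scale (`m·B < M` absorbs the tie-break):
  `θ · δ(S) ≤ γ(S)`,   `δ(S)` = `e`-slope change of the columns of `S`, `γ(S)` = change of the coarse cost `Σ r + Σ c` over `S`.
Part 3 adds the same inequality at the later slope for the reversed move and concludes that EVERY balanced circuit of class moves between
two consecutive dominant terms points UP in slope — the non-counting mechanism behind the sector law.

Bookkeeping lemmas (`sum_over_sum_type`, `card_filter_eq_sum_ite`, `count_update`, `balance_sides`, `sum_ite_inr_le_card`,
`tropWeight_sector`, `sum_rowClass`) are stated for reuse by part 3; full support ⇒ presence is the tree's `termSign_ne_zero_of_full`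
(`…TropicalBSeparable`).
[this file; the fibrewise bijection is Mathlib's `Equiv.ofFiberEquiv`]
-/

set_option linter.dupNamespace false
set_option autoImplicit false

namespace Summit.ValiantsHypothesis.ValiantsHypothesis.Theorems.KPlusLogSqLaw

namespace TwoSided

open Summit.ValiantsHypothesis.ValiantsHypothesis.Theorems.MatrixDescartes.Negative
open scoped BigOperators
open Finset

variable {m K : ℕ}

/-! ## 1. Bookkeeping lemmas -/

/-- a sum over a finset of a sum type splits into its two sides. [folklore] -/
theorem sum_over_sum_type {α β : Type*} [Fintype α] [Fintype β] [DecidableEq α] [DecidableEq β]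
    (S : Finset (α ⊕ β)) (F : α ⊕ β → ℤ) :
    ∑ i ∈ S, F i = (∑ a, if Sum.inl a ∈ S then F (Sum.inl a) else 0) +
      ∑ b, if Sum.inr b ∈ S then F (Sum.inr b) else 0 := by
  have h1 : ∑ i ∈ S, F i = ∑ i, (if i ∈ S then F i else 0) := by
    rw [Finset.sum_ite_mem, Finset.univ_inter]
  rw [h1, Fintype.sum_sum_type]

/-- the number of elements of a class, as an indicator sum. [folklore] -/
theorem card_filter_eq_sum_ite {ι : Type*} (s : Finset ι) (P : ι → Prop) [DecidablePred P] :
    ((s.filter P).card : ℤ) = ∑ i ∈ s, if P i then (1 : ℤ) else 0 := by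
  rw [Finset.card_filter]
  push_cast
  rfl

/-- **Realisation.**  Two class maps with the same class counts are intertwined by a permutation. [folklore] -/
theorem exists_perm_of_card_eq (cR cC : Fin m → Fin K)
    (h : ∀ l, (univ.filter fun a => cR a = l).card = (univ.filter fun b => cC b = l).card) :
    ∃ σ : Equiv.Perm (Fin m), ∀ b, cR (σ b) = cC b := by
  classical
  have hcard : ∀ l, Fintype.card {b // cC b = l} = Fintype.card {a // cR a = l} := by
    intro l
    rw [Fintype.card_subtype, Fintype.card_subtype, h l]
  exact ⟨Equiv.ofFiberEquiv (f := cC) (g := cR) fun l => Fintype.equivOfCardEq (hcard l),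
    fun b => Equiv.ofFiberEquiv_map _ b⟩

/-- the weight of a term in the two-sided separable sector. [this file] -/
theorem tropWeight_sector (d : Fin K → ℕ) (v : Fin m → Fin m → Fin K → ℤ) (r c : Fin m → Fin K → ℤ)
    (w : Fin m → Fin m → ℤ) (M : ℤ) (hv : ∀ a b l, v a b l = M * (r a l + c b l) + w a b) (θ : ℤ)
    (q : Equiv.Perm (Fin m) × (Fin m → Fin K)) :
    tropWeight d v θ q = θ * ∑ b, (d (q.2 b) : ℤ) -
      (M * (∑ b, r (q.1 b) (q.2 b) + ∑ b, c b (q.2 b)) + ∑ b, w (q.1 b) b) := by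
  unfold tropWeight
  congr 1
  simp only [hv, mul_add, Finset.sum_add_distrib, Finset.mul_sum]

/-- row re-indexing: a per-column sum of a ROW-class quantity is a sum over rows. [folklore] -/
theorem sum_rowClass (σ : Equiv.Perm (Fin m)) (cR : Fin m → Fin K) (lam : Fin m → Fin K)
    (h : ∀ b, cR (σ b) = lam b) (F : Fin m → Fin K → ℤ) :
    ∑ b, F (σ b) (lam b) = ∑ a, F a (cR a) := by
  have : ∀ b, F (σ b) (lam b) = (fun a => F a (cR a)) (σ b) := fun b => by simp [h b]
  simp_rw [this]
  exact Equiv.sum_comp σ (fun a => F a (cR a))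


/-- updating a class map on a marked set changes a class count by (marked new) − (marked old). [folklore] -/
theorem count_update (S : Finset (Fin m ⊕ Fin m)) (side : Fin m → Fin m ⊕ Fin m) (old new : Fin m → Fin K)
    (l : Fin K) :
    (∑ x, if (if side x ∈ S then new x else old x) = l then (1 : ℤ) else 0) =
      (∑ x, if old x = l then (1 : ℤ) else 0) +
        ((∑ x, if side x ∈ S then (if new x = l then (1 : ℤ) else 0) else 0) -
          ∑ x, if side x ∈ S then (if old x = l then (1 : ℤ) else 0) else 0) := by
  rw [← Finset.sum_sub_distrib, ← Finset.sum_add_distrib]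
  refine Finset.sum_congr rfl fun x _ => ?_
  by_cases h : side x ∈ S <;> by_cases h1 : old x = l <;> by_cases h2 : new x = l <;> simp [h, h1, h2]

/-- the balance of a family of arcs, read on the two sides. [folklore] -/
theorem balance_sides (S : Finset (Fin m ⊕ Fin m)) (tlR hdR tlC hdC : Fin m → Fin K) (l : Fin K)
    (h : (S.filter fun i => Sum.elim hdR hdC i = l).card = (S.filter fun i => Sum.elim tlR tlC i = l).card) :
    (∑ a, if Sum.inl a ∈ S then (if hdR a = l then (1 : ℤ) else 0) else 0) +
        (∑ b, if Sum.inr b ∈ S then (if hdC b = l then (1 : ℤ) else 0) else 0) =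
      (∑ a, if Sum.inl a ∈ S then (if tlR a = l then (1 : ℤ) else 0) else 0) +
        (∑ b, if Sum.inr b ∈ S then (if tlC b = l then (1 : ℤ) else 0) else 0) := by
  have h' : ((S.filter fun i => Sum.elim hdR hdC i = l).card : ℤ) =
      ((S.filter fun i => Sum.elim tlR tlC i = l).card : ℤ) := by exact_mod_cast h
  rw [card_filter_eq_sum_ite, card_filter_eq_sum_ite, sum_over_sum_type, sum_over_sum_type] at h'
  simp only [Sum.elim_inl, Sum.elim_inr] at h'
  convert h' using 3 <;> split_ifs <;> rfl

/-- a marked count is at most the corresponding one-sided filter count of the family. [folklore] -/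
theorem sum_ite_inr_le_card (S : Finset (Fin m ⊕ Fin m)) (tlR tlC : Fin m → Fin K) (l : Fin K) :
    (∑ b, if Sum.inr b ∈ S then (if tlC b = l then (1 : ℤ) else 0) else 0) ≤
      ((S.filter fun i => Sum.elim tlR tlC i = l).card : ℤ) := by
  classical
  rw [card_filter_eq_sum_ite, sum_over_sum_type]
  simp only [Sum.elim_inl, Sum.elim_inr]
  exact le_add_of_nonneg_left (Finset.sum_nonneg fun a _ => by split_ifs <;> norm_num)

/-- a marked indicator count is nonnegative. [folklore] -/
theorem sum_ite_ite_nonneg (S : Finset (Fin m ⊕ Fin m)) (tlC : Fin m → Fin K) (l : Fin K) :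
    0 ≤ ∑ b, if Sum.inr b ∈ S then (if tlC b = l then (1 : ℤ) else 0) else 0 :=
  Finset.sum_nonneg fun a _ => by split_ifs <;> norm_num

/-! ## 2. The move inequality -/

/-- **Move inequality.**  In the two-sided separable sector (`d = M·e`, `v a b l = M(r a l + c b l) + w a b`, `0 ≤ w ≤ B`,
`mB < M`, full support), let `p` be dominant at the integer slope `θ`, `p'` any term, and `S` a nonempty family of CHANGED agents
(rows `a` whose class under `p'` differs from that under `p`, read as arcs old class → new class; columns `b` likewise, read as arcs
new class → old class) which is BALANCED (every class has as many heads as tails in `S`).  Moving exactly the agents of `S` to their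
`p'`-classes is again a Leibniz term (balance = row histogram matches column histogram), present by full support, so dominance of `p`
prices the move: `θ · (e-slope change of S) ≤ (coarse cost change of S)`. [this file] -/
theorem move_ineq (e : Fin K → ℕ) (M : ℕ) (d : Fin K → ℕ) (hd : ∀ l, d l = M * e l)
    (r c : Fin m → Fin K → ℤ) (w : Fin m → Fin m → ℤ) (B : ℤ)
    (hw0 : ∀ a b, 0 ≤ w a b) (hwB : ∀ a b, w a b ≤ B) (hMB : (m : ℤ) * B < M)
    (v ε : Fin m → Fin m → Fin K → ℤ) (hv : ∀ a b l, v a b l = (M : ℤ) * (r a l + c b l) + w a b)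
    (hε : ∀ a b l, ε a b l ≠ 0) {θ : ℤ} {p : Equiv.Perm (Fin m) × (Fin m → Fin K)} (hp : IsDominant d v ε θ p)
    (p' : Equiv.Perm (Fin m) × (Fin m → Fin K)) (S : Finset (Fin m ⊕ Fin m)) (hSne : S.Nonempty)
    (hSD : ∀ i ∈ S, Sum.elim (fun a => p.2 (p.1.symm a)) (fun b => p'.2 b) i ≠
      Sum.elim (fun a => p'.2 (p'.1.symm a)) (fun b => p.2 b) i)
    (hSbal : ∀ l, (S.filter fun i => Sum.elim (fun a => p'.2 (p'.1.symm a)) (fun b => p.2 b) i = l).card =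
      (S.filter fun i => Sum.elim (fun a => p.2 (p.1.symm a)) (fun b => p'.2 b) i = l).card) :
    θ * (∑ b, if Sum.inr b ∈ S then ((e (p'.2 b) : ℤ) - e (p.2 b)) else 0) ≤
      (∑ a, if Sum.inl a ∈ S then (r a (p'.2 (p'.1.symm a)) - r a (p.2 (p.1.symm a))) else 0) +
        ∑ b, if Sum.inr b ∈ S then (c b (p'.2 b) - c b (p.2 b)) else 0 := by
  classical
  -- sizes: `m ≥ 1`, `0 ≤ B`, `0 < M`
  obtain ⟨i₀, hi₀⟩ := hSne
  have hm : 0 < m := by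
    rcases i₀ with a | b
    · exact Fin.pos a
    · exact Fin.pos b
  have hB : 0 ≤ B := (hw0 ⟨0, hm⟩ ⟨0, hm⟩).trans (hwB _ _)
  have hM : (0 : ℤ) < M := lt_of_le_of_lt (mul_nonneg (by positivity) hB) hMB
  -- the old and new class maps
  set cp : Fin m → Fin K := fun a => p.2 (p.1.symm a) with hcp_def
  set cp' : Fin m → Fin K := fun a => p'.2 (p'.1.symm a) with hcp'_def
  set lq : Fin m → Fin K := fun b => if Sum.inr b ∈ S then p'.2 b else p.2 b with hlq_def
  set cq : Fin m → Fin K := fun a => if Sum.inl a ∈ S then cp' a else cp a with hcq_def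
  -- row histogram of `p` = column histogram of `p`
  have hrow : ∀ l, (∑ a, if cp a = l then (1 : ℤ) else 0) = ∑ b, if p.2 b = l then (1 : ℤ) else 0 := by
    intro l
    simpa [hcp_def] using Equiv.sum_comp p.1.symm (fun b => if p.2 b = l then (1 : ℤ) else 0)
  -- class counts of the moved maps agree
  have hcnt : ∀ l, (univ.filter fun a => cq a = l).card = (univ.filter fun b => lq b = l).card := by
    intro l
    have h1 := count_update S Sum.inl cp cp' l
    have h2 := count_update S Sum.inr p.2 p'.2 l
    have h3 := balance_sides S cp cp' p'.2 p.2 l (hSbal l)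
    have h4 := hrow l
    have e1 : ((univ.filter fun a => cq a = l).card : ℤ) = ∑ x, if cq x = l then (1 : ℤ) else 0 :=
      card_filter_eq_sum_ite _ _
    have e2 : ((univ.filter fun b => lq b = l).card : ℤ) = ∑ x, if lq x = l then (1 : ℤ) else 0 :=
      card_filter_eq_sum_ite _ _
    have : ((univ.filter fun a => cq a = l).card : ℤ) = ((univ.filter fun b => lq b = l).card : ℤ) := by
      rw [e1, e2]
      simp only [hcq_def, hlq_def] at *
      linarith
    exact_mod_cast this
  -- the moved term `q`
  obtain ⟨σq, hσq⟩ := exists_perm_of_card_eq cq lq hcnt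
  set q : Equiv.Perm (Fin m) × (Fin m → Fin K) := (σq, lq) with hq_def
  -- `q ≠ p`
  have hqp : q ≠ p := by
    intro hqp
    have h1 : σq = p.1 := congrArg Prod.fst hqp
    have h2 : lq = p.2 := congrArg Prod.snd hqp
    rcases i₀ with a | b
    · have hne := hSD _ hi₀
      simp only [Sum.elim_inl] at hne
      have := hσq (p.1.symm a)
      rw [h2, h1, Equiv.apply_symm_apply] at this
      -- `cq a = cp a`, but `a ∈ S` so `cq a = cp' a ≠ cp a`
      simp only [hcq_def, hi₀, if_true, hcp'_def, hcp_def] at this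
      exact hne this.symm
    · have hne := hSD _ hi₀
      simp only [Sum.elim_inr] at hne
      have := congrFun h2 b
      simp only [hlq_def, hi₀, if_true] at this
      exact hne this
  -- dominance prices the move
  have hlt := hp.2 q hqp (termSign_ne_zero_of_full ε hε q)
  rw [tropWeight_sector d v r c w M hv θ q, tropWeight_sector d v r c w M hv θ p] at hlt
  -- rewrite the row sums over rows
  have hRq : ∑ b, r (q.1 b) (q.2 b) = ∑ a, r a (cq a) := sum_rowClass σq cq lq hσq r
  have hRp : ∑ b, r (p.1 b) (p.2 b) = ∑ a, r a (cp a) :=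
    sum_rowClass p.1 cp p.2 (fun b => by simp [hcp_def]) r
  -- the four differences
  have hSd : ∑ b, (d (q.2 b) : ℤ) = ∑ b, (d (p.2 b) : ℤ) +
      (M : ℤ) * ∑ b, if Sum.inr b ∈ S then ((e (p'.2 b) : ℤ) - e (p.2 b)) else 0 := by
    rw [Finset.mul_sum, ← Finset.sum_add_distrib]
    refine Finset.sum_congr rfl fun b _ => ?_
    show (d (lq b) : ℤ) = _
    simp only [hlq_def, hd]
    split_ifs <;> push_cast <;> ring
  have hR : ∑ a, r a (cq a) = ∑ a, r a (cp a) +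
      ∑ a, if Sum.inl a ∈ S then (r a (p'.2 (p'.1.symm a)) - r a (p.2 (p.1.symm a))) else 0 := by
    rw [← Finset.sum_add_distrib]
    refine Finset.sum_congr rfl fun a _ => ?_
    simp only [hcq_def, hcp_def, hcp'_def]
    split_ifs <;> ring
  have hC : ∑ b, c b (q.2 b) = ∑ b, c b (p.2 b) + ∑ b, if Sum.inr b ∈ S then (c b (p'.2 b) - c b (p.2 b)) else 0 := by
    rw [← Finset.sum_add_distrib]
    refine Finset.sum_congr rfl fun b _ => ?_
    show c b (lq b) = _
    simp only [hlq_def]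
    split_ifs <;> ring
  have hWp : 0 ≤ ∑ b, w (p.1 b) b := Finset.sum_nonneg fun b _ => hw0 _ _
  have hWq : ∑ b, w (q.1 b) b ≤ m * B := by
    calc ∑ b, w (q.1 b) b ≤ ∑ _b : Fin m, B := Finset.sum_le_sum fun b _ => hwB _ _
      _ = m * B := by simp
  rw [hRq, hRp, hSd, hR, hC] at hlt
  -- `M · (θ δ − γ) < M`, hence `θ δ − γ ≤ 0`
  set δ := ∑ b, if Sum.inr b ∈ S then ((e (p'.2 b) : ℤ) - e (p.2 b)) else 0
  set γR := ∑ a, if Sum.inl a ∈ S then (r a (p'.2 (p'.1.symm a)) - r a (p.2 (p.1.symm a))) else 0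
  set γC := ∑ b, if Sum.inr b ∈ S then (c b (p'.2 b) - c b (p.2 b)) else 0
  have key : (M : ℤ) * (θ * δ - (γR + γC)) < M * 1 := by nlinarith
  have key2 : θ * δ - (γR + γC) < 1 := lt_of_mul_lt_mul_left key hM.le
  linarith



end TwoSided

end Summit.ValiantsHypothesis.ValiantsHypothesis.Theorems.KPlusLogSqLaw
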